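import Mathlib.Analysis.Calculus.ContDiff.Basic
import Mathlib.Analysis.Calculus.Deriv.Comp
import Mathlib.Analysis.Calculus.Deriv.Mul
import Mathlib.Analysis.Calculus.Deriv.Add
import Mathlib.MeasureTheory.Integral.IntervalIntegral.FundThmCalculus

/-!
# `Balaban1983to89.B12FirstExpansion34` — [Balaban1987RG1] (3.4) p. 270: the first expansion (fundamental theorem of
calculus along the ray `t ↦ t𝐇_k(B′)`, the partition of unity `1 = Σ_□ ζ_□`, and the `t_□`-derivatives at `t_□ = 0`)

HONEST FRAMING (cell `lit-balaban`, verbatim): statement-level skeleton of published theorems with citation tags; proofs where landed; nothing here is a claim about the Yang–Mills mass gap.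

CITATION HEADER.  T. Bałaban, *Renormalization group approach to lattice gauge field theories. I. Generation of
effective actions in a small field approximation and a coupling constant renormalization in four dimensions*,
Commun. Math. Phys. **109** (1987) 249–301, doi:10.1007/bf01215223 [Balaban1987RG1] (cell paper B12; held text
`paper:balaban1987-cmp109-rg-i-small-field`, journal page = PDF page + 248; the display was read as an image from the
page render `b2b-balaban-ref1/pages/1987-cmp109-rg-I-small-field/…-p022-x2.png` (p. 270)).  Unit `lit-balaban-r20`
(fold owner of B12), SKELETON row `B12.Eq3.3-3.4` — this file types and PROVES the display (3.4); the display (3.3)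
(the gauge-invariance rewriting «where we have used the results of Sect. G [15], and the equality (97) [12]») is a
configuration-space identity of the series' averaging operations and is NOT reproduced here (rows `B11.SectG`,
`B7.Eq97`).  The `t_□`-derivative produced by (3.4) is the object whose Cauchy-integral extension is (3.15)
(`B12CauchyRemainder354.deriv_eq_circleIntegral_315`).

WHAT IS PRINTED (p. 270 [PDF 22], verbatim).  *«Let us take the partition π_k. We construct a cover of the space T by
cubes □, which are unions of 2^d neighbouring cubes from π_k. For this cover we take a partition of unity 1 = Σ_□ ζ_□
with smooth functions ζ_□. […] Next we have
  𝐄^{(j)}(U_k(exp iB′V^{(k)})) − 𝐄^{(j)}(U_k(V^{(k)}))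
    = ∫₀¹ dt (d/dt) 𝐄^{(j)}(U_j(exp iQ_j(ηt𝐇_k(B′)) Ū^j_{k+1}))
    = ∫₀¹ dt ⟨((δ/δ𝐇) 𝐄^{(j)})(U_j(exp iQ_j(ηt𝐇_k(B′)) Ū^j_{k+1})), 𝐇_k(B′)⟩
    = Σ_□ ∫₀¹ dt ⟨((δ/δ𝐇) 𝐄^{(j)})(U_j(exp iQ_j(ηt𝐇_k(B′)) Ū^j_{k+1})), ζ_□𝐇_k(B′)⟩
    = Σ_□ ∫₀¹ dt (d/dt_□) 𝐄^{(j)}(U_j(exp iQ_j(η(t + t_□ζ_□)𝐇_k(B′)) Ū^j_{k+1}))|_{t_□=0}.   (3.4)»*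
(The left member equals the first line by (3.3).)

HOW IT IS FORMALIZED.  Write `f(𝐇) := 𝐄^{(j)}(U_j(exp iQ_j(η𝐇) Ū^j_{k+1}))` — a map from a real normed space `E` of
fields 𝐇 to a complete normed space `F`, of class `C¹` on an open set `s` containing the segment `{t𝐇 : t ∈ [0,1]}`
(the paper: analytic on the spaces of Sect. 1) — `H := 𝐇_k(B′)`, and `Hloc □ := ζ_□𝐇_k(B′)` a finite family with
`Σ_□ Hloc □ = H` (the partition of unity).  Then the four printed equalities are, in order: the fundamental theorem of
calculus for `t ↦ f(tH)` (`eq34_ftc`), the chain rule `(d/dt) f(tH) = ⟨Df(tH), H⟩` (`deriv_ray`), linearity of the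
differential in the direction + `Σ_□ ζ_□ = 1` (`fderiv_partition`), and `⟨Df(tH), Hloc □⟩ = (d/dt_□) f(tH +
t_□ Hloc □)|_{t_□=0}` since `(t + t_□ζ_□)𝐇 = t𝐇 + t_□ζ_□𝐇` (`deriv_tbox`); assembled: `eq34`.  Everything is PROVED
from Mathlib (FTC `intervalIntegral.integral_eq_sub_of_hasDerivAt`, `HasFDerivAt.comp_hasDerivAt`, `map_sum`,
`intervalIntegral.integral_finsetSum`); no carrier of the cell is needed.  The smoothness/support properties of ζ_□
(«ζ(t) = 1 for |t| ≤ 1/3, … derivatives up to the second order bounded by 5») play no role in (3.4) itself (only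
`Σ_□ ζ_□ = 1` does) and are not modelled here.
-/

namespace Literature.MathematicalPhysics.QuantumFieldTheory.Balaban1983to89.B12FirstExpansion34

open Set Filter MeasureTheory intervalIntegral
open scoped Topology BigOperators

variable {E F : Type*} [NormedAddCommGroup E] [NormedSpace ℝ E] [NormedAddCommGroup F] [NormedSpace ℝ F]

/-! ## The chain rules along the ray and along the `t_□`-lines -/

/-- Second equality of (3.4): for `f` differentiable at `tH`, `(d/dt) f(tH) = ⟨Df(tH), H⟩` — the pairing
`⟨(δ/δ𝐇)𝐄^{(j)}(… t𝐇 …), 𝐇⟩`. [cite: Balaban1987RG1, (3.4) p.270] -/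
theorem hasDerivAt_ray {f : E → F} (H : E) {t : ℝ} (hf : DifferentiableAt ℝ f (t • H)) :
    HasDerivAt (fun τ : ℝ => f (τ • H)) (fderiv ℝ f (t • H) H) t := by
  have hray : HasDerivAt (fun τ : ℝ => τ • H) H t := by
    simpa using HasDerivAt.smul_const (hasDerivAt_id t) H
  exact hf.hasFDerivAt.comp_hasDerivAt t hray

/-- Second equality of (3.4), `deriv` form: `deriv (t ↦ f(tH)) t = Df(tH) H`. [cite: Balaban1987RG1, (3.4) p.270] -/
theorem deriv_ray {f : E → F} (H : E) {t : ℝ} (hf : DifferentiableAt ℝ f (t • H)) :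
    deriv (fun τ : ℝ => f (τ • H)) t = fderiv ℝ f (t • H) H :=
  (hasDerivAt_ray H hf).deriv

/-- Fourth equality of (3.4), one cube: for `f` differentiable at `x` (in the paper `x = t𝐇_k(B′)`) and a direction `v`
(in the paper `v = ζ_□𝐇_k(B′)`, so that `(t + t_□ζ_□)𝐇 = x + t_□v`),
`(d/dt_□) f(x + t_□ v)|_{t_□ = 0} = ⟨Df(x), v⟩`. [cite: Balaban1987RG1, (3.4) p.270] -/
theorem hasDerivAt_tbox {f : E → F} {x : E} (v : E) (hf : DifferentiableAt ℝ f x) :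
    HasDerivAt (fun τ : ℝ => f (x + τ • v)) (fderiv ℝ f x v) 0 := by
  have hline : HasDerivAt (fun τ : ℝ => x + τ • v) v 0 := by
    simpa using (HasDerivAt.smul_const (hasDerivAt_id (0 : ℝ)) v).const_add x
  exact hf.hasFDerivAt.comp_hasDerivAt_of_eq 0 hline (by simp)

/-- Fourth equality of (3.4), `deriv` form: `deriv (t_□ ↦ f(x + t_□ v)) 0 = Df(x) v`.
[cite: Balaban1987RG1, (3.4) p.270] -/
theorem deriv_tbox {f : E → F} {x : E} (v : E) (hf : DifferentiableAt ℝ f x) :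
    deriv (fun τ : ℝ => f (x + τ • v)) 0 = fderiv ℝ f x v :=
  (hasDerivAt_tbox v hf).deriv

/-- Third equality of (3.4): the partition of unity `Σ_□ ζ_□𝐇 = 𝐇` splits the pairing,
`⟨Df(x), H⟩ = Σ_□ ⟨Df(x), Hloc □⟩` (linearity of the differential). [cite: Balaban1987RG1, (3.4) p.270] -/
theorem fderiv_partition (f : E → F) (x : E) {ι : Type*} (S : Finset ι) (Hloc : ι → E) {H : E}
    (hsum : ∑ c ∈ S, Hloc c = H) :
    fderiv ℝ f x H = ∑ c ∈ S, fderiv ℝ f x (Hloc c) := by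
  rw [← hsum, map_sum]

/-! ## The first expansion (3.4) -/

section FTC

variable [CompleteSpace F]

omit [CompleteSpace F] in
/-- Continuity of `t ↦ ⟨Df(tH), v⟩` on `[0,1]` for `f` of class `C¹` on an open `s ⊇ {tH : t ∈ [0,1]}` (gives the
integrability of every integrand in (3.4)). [cite: Balaban1987RG1, (3.4) p.270] (elementary API for (3.4)) -/
theorem continuousOn_fderiv_ray {s : Set E} (hs : IsOpen s) {f : E → F} (hf : ContDiffOn ℝ 1 f s) (H v : E)
    (hseg : ∀ t ∈ Icc (0 : ℝ) 1, t • H ∈ s) :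
    ContinuousOn (fun t : ℝ => fderiv ℝ f (t • H) v) (Icc (0 : ℝ) 1) := by
  have hD : ContinuousOn (fderiv ℝ f) s := hf.continuousOn_fderiv_of_isOpen hs le_rfl
  have hray : ContinuousOn (fun t : ℝ => t • H) (Icc (0 : ℝ) 1) := (continuous_id.smul continuous_const).continuousOn
  have hcomp : ContinuousOn (fun t : ℝ => fderiv ℝ f (t • H)) (Icc (0 : ℝ) 1) :=
    hD.comp hray fun t ht => hseg t ht
  exact (ContinuousLinearMap.apply ℝ F v).continuous.comp_continuousOn hcomp

/-- First and second equalities of (3.4): the fundamental theorem of calculus along the ray,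
`f(H) − f(0) = ∫₀¹ dt ⟨Df(tH), H⟩` (`= ∫₀¹ dt (d/dt) f(tH)`), for `f` of class `C¹` on an open `s` containing the
segment `{tH : t ∈ [0,1]}`. [cite: Balaban1987RG1, (3.4) p.270] -/
theorem eq34_ftc {s : Set E} (hs : IsOpen s) {f : E → F} (hf : ContDiffOn ℝ 1 f s) (H : E)
    (hseg : ∀ t ∈ Icc (0 : ℝ) 1, t • H ∈ s) :
    f H - f 0 = ∫ t in (0 : ℝ)..1, fderiv ℝ f (t • H) H := by
  have hdiff : ∀ t ∈ Icc (0 : ℝ) 1, DifferentiableAt ℝ f (t • H) := fun t ht =>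
    (hf.differentiableOn one_ne_zero).differentiableAt (hs.mem_nhds (hseg t ht))
  have hderiv : ∀ t ∈ uIcc (0 : ℝ) 1, HasDerivAt (fun τ : ℝ => f (τ • H)) (fderiv ℝ f (t • H) H) t := by
    intro t ht
    rw [uIcc_of_le zero_le_one] at ht
    exact hasDerivAt_ray H (hdiff t ht)
  have hint : IntervalIntegrable (fun t : ℝ => fderiv ℝ f (t • H) H) volume 0 1 := by
    refine ContinuousOn.intervalIntegrable ?_
    rw [uIcc_of_le zero_le_one]
    exact continuousOn_fderiv_ray hs hf H H hseg
  have h := intervalIntegral.integral_eq_sub_of_hasDerivAt hderiv hint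
  simp only [one_smul, zero_smul] at h
  exact h.symm

/-- **(3.4)** p. 270 [PDF 22], the first expansion, all four equalities assembled: for `f` (in the paper
`f(𝐇) = 𝐄^{(j)}(U_j(exp iQ_j(η𝐇) Ū^j_{k+1}))`) of class `C¹` on an open `s ⊇ {tH : t ∈ [0,1]}` (`H = 𝐇_k(B′)`)
and a finite family `Hloc □` (`= ζ_□𝐇_k(B′)`) with `Σ_□ Hloc □ = H` (the partition of unity `1 = Σ_□ ζ_□`),
`f(H) − f(0) = Σ_□ ∫₀¹ dt (d/dt_□) f(tH + t_□ Hloc □)|_{t_□=0}`.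
[cite: Balaban1987RG1, (3.4) p.270] -/
theorem eq34 {s : Set E} (hs : IsOpen s) {f : E → F} (hf : ContDiffOn ℝ 1 f s) (H : E)
    (hseg : ∀ t ∈ Icc (0 : ℝ) 1, t • H ∈ s) {ι : Type*} (S : Finset ι) (Hloc : ι → E)
    (hsum : ∑ c ∈ S, Hloc c = H) :
    f H - f 0 = ∑ c ∈ S, ∫ t in (0 : ℝ)..1, deriv (fun τ : ℝ => f (t • H + τ • Hloc c)) 0 := by
  have hdiff : ∀ t ∈ Icc (0 : ℝ) 1, DifferentiableAt ℝ f (t • H) := fun t ht =>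
    (hf.differentiableOn one_ne_zero).differentiableAt (hs.mem_nhds (hseg t ht))
  -- first + second equality (FTC along the ray), third (partition of unity)
  rw [eq34_ftc hs hf H hseg]
  have hsplit : (∫ t in (0 : ℝ)..1, fderiv ℝ f (t • H) H)
      = ∫ t in (0 : ℝ)..1, ∑ c ∈ S, fderiv ℝ f (t • H) (Hloc c) := by
    refine intervalIntegral.integral_congr fun t _ => ?_
    exact fderiv_partition f (t • H) S Hloc hsum
  rw [hsplit, intervalIntegral.integral_finsetSum fun c _ => ?_]
  -- fourth equality (the t_□-derivative at 0), termwise on [0,1]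
  · refine Finset.sum_congr rfl fun c _ => intervalIntegral.integral_congr fun t ht => ?_
    rw [uIcc_of_le zero_le_one] at ht
    exact (deriv_tbox (Hloc c) (hdiff t ht)).symm
  · refine ContinuousOn.intervalIntegrable ?_
    rw [uIcc_of_le zero_le_one]
    exact continuousOn_fderiv_ray hs hf H (Hloc c) hseg

/-- (3.4), the middle form (third member): `f(H) − f(0) = Σ_□ ∫₀¹ dt ⟨Df(tH), Hloc □⟩`.
[cite: Balaban1987RG1, (3.4) p.270] -/
theorem eq34_pairing {s : Set E} (hs : IsOpen s) {f : E → F} (hf : ContDiffOn ℝ 1 f s) (H : E)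
    (hseg : ∀ t ∈ Icc (0 : ℝ) 1, t • H ∈ s) {ι : Type*} (S : Finset ι) (Hloc : ι → E)
    (hsum : ∑ c ∈ S, Hloc c = H) :
    f H - f 0 = ∑ c ∈ S, ∫ t in (0 : ℝ)..1, fderiv ℝ f (t • H) (Hloc c) := by
  rw [eq34_ftc hs hf H hseg]
  have hsplit : (∫ t in (0 : ℝ)..1, fderiv ℝ f (t • H) H)
      = ∫ t in (0 : ℝ)..1, ∑ c ∈ S, fderiv ℝ f (t • H) (Hloc c) := by
    refine intervalIntegral.integral_congr fun t _ => ?_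
    exact fderiv_partition f (t • H) S Hloc hsum
  rw [hsplit, intervalIntegral.integral_finsetSum fun c _ => ?_]
  refine ContinuousOn.intervalIntegrable ?_
  rw [uIcc_of_le zero_le_one]
  exact continuousOn_fderiv_ray hs hf H (Hloc c) hseg

end FTC

end Literature.MathematicalPhysics.QuantumFieldTheory.Balaban1983to89.B12FirstExpansion34
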